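/-
Copyright (c) 2026 the pub-hodgecm-mathlib formalisation cell (harness21).  Prover seat hodgecm-mathlib-R90-C10-p01 (g2), SLAB R90-TF, section S1 «Ch. 10∕12 local», lent to
«U4-RAM :182 B_pos» (line (D-1) B_pos-inert, line lead R90-C10-p05 (g2), S1 chair R90-C10-plan (g2) R-S1-11; road owner K2E3-plan (g5)); crux H413 = `stmt-HodgeConjecture-24833`;
socket U4Keys :182 (U4f-χ₁-ram-one-pos) under S1's A2′.  Brick (B-2a), dealt BY NAME 2026-09-04T23:20:24Z.
KERNEL module: THEOREMS ONLY (no definition, no named fact, no `sorry`, no instance, no notation); MODEL level.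
-/
import Summits.HodgeConjecture.HodgeConjecture.Theorems.K2E3TwoDepthDepthWitnessCover    -- ★ p862713 (K2E3-p37 (g2)): `cover_arith`, `cover_arith_zero`, `v_pow_eq_exp`, `exists_depth_witness_twoDepth`; brings ★ p862593 `exists_familyX_witness_twoDepth`, ★ `v_mul_v_le_of_rel`
import HarnessLib

/-!
# R90 · S1 ∕ U4Keys :182 (U4f-χ₁-ram-one-pos), line (D-1) B_pos — brick (B-2a): THE DEPTH WITNESS ON THE INTERMEDIATE LOWER CELLS OF THE TWO-DEPTH GROUP AT `k = 0`
# «at `cond_F = 1` (`s + s′ = 1`) family Z never occurs: the witness is ALWAYS the cond_E witness `c₁`»   [Roche1998 §3–§4; Casselman1995 §6.3; BruhatTits1972 (6.4.9)]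

Cell `hodgecm-mathlib`, SLAB R90-TF, section S1, crux H413 = `stmt-HodgeConjecture-24833` (lane `--supports … --as helper`), route of record `HCCMUnconditional` (no route verbs);
prover seat `hodgecm-mathlib-R90-C10-p01` (g2).  THEOREMS ONLY; ★-only imports.  NOT THE PAYER of :182.

THE POINT.  ★ p862713 `K2E3TwoDepthDepthWitnessCover.exists_depth_witness_twoDepth` covers the intermediate lower cells of `J_e`, `e = (r, s; r′, s′)`, `r + r′ = m + 1`,
`s + s′ = k + 1`, by the witness families X (witness `c₁ ∈ 𝔭ᵐ`, arbitrary) and Z (witness `c₂ ∈ 𝔭ᵏ`, `σ`-fixed); its arithmetic (`cover_arith`, `cover_arith_zero`) puts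
`1 ≤ k` in front of every Z-branch.  At `k = 0` (`s + s′ = 1`, i.e. `(m, k) = (n − 1, 0)`: the cells that line (D-1) B_pos calls «θ-irrelevant») the Z-branches are therefore EMPTY
and the conclusion holds with the single witness `c = c₁` and NO `σ`-fixed letter `c₂`:
* **`exists_depth_witness_twoDepth_kZero`** — binders = ★ `exists_depth_witness_twoDepth`'s with `k := 0` (`hkm`, `c₂`, `hσc₂`, `hc₂` deleted), conclusion
  `∃ u ∈ N, ū⁻¹uū ∈ J_e ∧ ∃ ε, |ε| ≤ |ϖ|^{m+1} ∧ (ū⁻¹uū)₀₀ = (1 + c₁)(1 + ε)`.  Proof = the ★ proof's case analysis re-assembled from its public lemmas: `x = 0` ⟹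
  `cover_arith_zero` yields `1 ≤ 0`, absurd; `x ≠ 0` ⟹ `cover_arith` yields the X-regime (then ★ `exists_familyX_witness_twoDepth` with `c := c₁`) or `1 ≤ 0`, absurd.
Consumer: R90-C10-p05 (g2)'s (D-1) B_pos leaf (brick (B-2) first half).
HONEST LABEL: HC_CM is proved only modulo the 7 printed citations (2 remaining named inputs: hLiu418 = `stmt-HodgeConjecture-24832`, h413 = `stmt-HodgeConjecture-24833`)
until rung 0 closes; count-neutral — this file does NOT pay :182; no printed citation is discharged.

## References
* [Roche1998] A. Roche, *Types and Hecke algebras for principal series representations of split reductive p-adic groups*, Ann. Sci. ÉNS (4) 31 (1998), §3–§4.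
* [Casselman1995] W. Casselman, *Introduction to the theory of admissible representations of `p`-adic reductive groups* (1995), §6.3.
* [BruhatTits1972] F. Bruhat, J. Tits, *Groupes réductifs sur un corps local I*, Publ. Math. IHÉS 41 (1972), (6.4.9).
* [Serre1979] J.-P. Serre, *Local Fields*, GTM 67 (1979), Ch. II §1.
-/

set_option autoImplicit false
-- the mandated namespace repeats the single-problem summit's segment (`HodgeConjecture.HodgeConjecture`)
set_option linter.dupNamespace false

noncomputable section

open Matrix Literature.NumberTheory.Automorphic Literature.NumberTheory.Automorphic.UnitaryGroup
open scoped Matrix MatrixGroups WithZero Pointwise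

namespace Summit.HodgeConjecture.HodgeConjecture.R90.S1.BranchBDepthWitnessKZero

open Summit.HodgeConjecture.HodgeConjecture.Cruxes.H413
open Summit.HodgeConjecture.HodgeConjecture.Cruxes.H413.K2E3TwoDepthDepthWitness
open Summit.HodgeConjecture.HodgeConjecture.Cruxes.H413.K2E3TwoDepthDepthWitnessCover

variable {K : Type*} [Field K] [Valued K ℤᵐ⁰] [ValuativeRel K] [(Valued.v : Valuation K ℤᵐ⁰).Compatible]
  (σ : K →+* K) {ϖ : K} {J : Matrix (Fin 3) (Fin 3) K} (hJ : J = (StdForm.antidiagonal 3).over K)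
  (hσ : ∀ a, σ (σ a) = a) (hvσ : ∀ a, Valued.v (σ a) = Valued.v a) (hvϖ : Valued.v ϖ = WithZero.exp (-1 : ℤ))
  (r s r' s' : ℕ) (Jg : Subgroup ↥(unitaryGroupOfForm σ J))
  (hJg : ∀ k, k ∈ Jg ↔ ∀ i j, Valued.v (((k : GL (Fin 3) K) : Matrix (Fin 3) (Fin 3) K) i j) ≤
    Valued.v ϖ ^ (![![0, r, s], ![r', 0, r], ![s', r', 0]] : Fin 3 → Fin 3 → ℕ) i j)

include hJ hσ hvσ hvϖ hJg in
/-- **DEPTH WITNESS ON EVERY INTERMEDIATE LOWER CELL OF `J_e` AT `k = 0` — ALWAYS THE cond_E WITNESS `c₁`.**  Exponents: `r + r′ = m + 1`, `s + s′ = 1`, `1 ≤ m`, `|r − r′| ≤ 1`,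
`|s − s′| ≤ 1`, aligned.  `ū ∈ U(σ, Φ₃)` with matrix `ū(x, z)` (`z + σz + xσx = 0`), `|z| ≤ 1`, off `J_e` and off the sharp big cell (★ p862713's letters verbatim); `c₁ ∈ 𝔭ᵐ`
arbitrary; a trace-one `t`.  Then some `u ∈ N` has `ū⁻¹ u ū ∈ J_e` and `(ū⁻¹ u ū)₀₀ = (1 + c₁)(1 + ε)` with `|ε| ≤ |ϖ|^{m+1}` — the `k = 0` corollary of ★
`exists_depth_witness_twoDepth`: every Z-branch of the ★ cover (`cover_arith`, `cover_arith_zero`) begins with `1 ≤ k`, so at `k = 0` only family X occurs (★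
`exists_familyX_witness_twoDepth` with `c := c₁`).  With `χ₁(1 + c₁) ≠ 1` (cond_E `= m + 1`) this is the letter `hwit` on the `(m, 0)` cells of line (D-1) B_pos.
[cite: Roche1998, §3–§4] [cite: Casselman1995, §6.3] [cite: BruhatTits1972, (6.4.9)] [cite: Serre1979, Ch. II §1] -/
theorem exists_depth_witness_twoDepth_kZero {m : ℕ} (hm : 1 ≤ m) (hrr : r + r' = m + 1) (hss : s + s' = 1)
    (hr1 : r ≤ r' + 1) (hr2 : r' ≤ r + 1) (hs1 : s ≤ s' + 1) (hs2 : s' ≤ s + 1) (hal : (r ≤ r' ∧ s ≤ s') ∨ (r' ≤ r ∧ s' ≤ s))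
    {nb : ↥(unitaryGroupOfForm σ J)} {x z c₁ t : K}
    (hnb : ((nb : GL (Fin 3) K) : Matrix (Fin 3) (Fin 3) K) = !![1, 0, 0; -σ x, 1, 0; z, x, 1]) (hrel : z + σ z + x * σ x = 0)
    (hz1 : Valued.v z ≤ 1)
    (hoff : ¬ (Valued.v x ≤ Valued.v ϖ ^ r' ∧ Valued.v z ≤ Valued.v ϖ ^ s'))
    (hshal : ¬ (Valued.v (x / z) ≤ Valued.v ϖ ^ r ∧ (Valued.v ϖ ^ s)⁻¹ ≤ Valued.v z))
    (hc₁ : Valued.v c₁ ≤ Valued.v ϖ ^ m) (ht : t + σ t = 1) (hvt : Valued.v t ≤ 1) :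
    ∃ u : ↥(unitaryGroupOfForm σ J), u ∈ unipotentU σ J ∧ nb⁻¹ * u * nb ∈ Jg ∧
      ∃ ε : K, Valued.v ε ≤ Valued.v ϖ ^ (m + 1) ∧
        (((nb⁻¹ * u * nb : ↥(unitaryGroupOfForm σ J)) : GL (Fin 3) K) : Matrix (Fin 3) (Fin 3) K) 0 0 = (1 + c₁) * (1 + ε) := by
  have eϖ : ∀ n : ℕ, Valued.v ϖ ^ n = WithZero.exp (-(n : ℤ)) := v_pow_eq_exp hvϖ
  -- `|x|² ≤ |z| ≤ 1`
  have hxx : Valued.v x * Valued.v x ≤ Valued.v z := v_mul_v_le_of_rel σ hvσ hrel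
  have hx1 : Valued.v x ≤ 1 := by
    by_contra h
    rw [not_le] at h
    exact absurd (h.trans_le ((le_mul_of_one_le_right' h.le).trans (hxx.trans hz1))) (lt_irrefl 1)
  -- `z ≠ 0` (else `x = 0` and `ū ∈ J_e`)
  have hz : z ≠ 0 := by
    rintro rfl
    have hx : x = 0 := by
      have h : Valued.v x * Valued.v x ≤ 0 := by rwa [map_zero] at hxx
      exact (Valuation.zero_iff _).1 (mul_self_eq_zero.1 (le_zero_iff.1 h))
    subst hx
    exact hoff ⟨by rw [map_zero]; exact zero_le, by rw [map_zero]; exact zero_le⟩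
  have hvz0 : Valued.v z ≠ 0 := (Valuation.ne_zero_iff _).2 hz
  obtain ⟨lz, ez⟩ : ∃ lz : ℤ, Valued.v z = WithZero.exp lz := ⟨_, (WithZero.exp_log hvz0).symm⟩
  have hz0' : lz ≤ 0 := by
    have h := hz1
    rw [ez, ← WithZero.exp_zero, WithZero.exp_le_exp] at h
    exact h
  rcases eq_or_ne x 0 with hx0 | hx0
  · -- the column `x = 0` would be family Z: impossible at `k = 0`
    subst hx0
    have hoffz : ¬ lz ≤ -(s' : ℤ) := fun h => hoff ⟨by rw [map_zero]; exact zero_le, by rw [ez, eϖ, WithZero.exp_le_exp]; omega⟩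
    have hshalz : ¬ -(-(s : ℤ)) ≤ lz := fun h =>
      hshal ⟨by rw [zero_div, map_zero]; exact zero_le, by rw [eϖ, ← WithZero.exp_neg, ez, WithZero.exp_le_exp]; omega⟩
    obtain ⟨hk1, -, -⟩ := cover_arith_zero (k := 0) hss hoffz hshalz
    exact absurd hk1 (by omega)
  · have hvx0 : Valued.v x ≠ 0 := (Valuation.ne_zero_iff _).2 hx0
    obtain ⟨lx, ex⟩ : ∃ lx : ℤ, Valued.v x = WithZero.exp lx := ⟨_, (WithZero.exp_log hvx0).symm⟩
    have hxx' : lx + lx ≤ lz := by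
      have h := hxx
      rw [ex, ez, ← WithZero.exp_add, WithZero.exp_le_exp] at h
      exact h
    have hoff' : ¬ (lx ≤ -(r' : ℤ) ∧ lz ≤ -(s' : ℤ)) := fun h =>
      hoff ⟨by rw [ex, eϖ, WithZero.exp_le_exp]; omega, by rw [ez, eϖ, WithZero.exp_le_exp]; omega⟩
    have hshal' : ¬ (lx + -lz ≤ -(r : ℤ) ∧ -(-(s : ℤ)) ≤ lz) := fun h =>
      hshal ⟨by rw [map_div₀, ex, ez, eϖ, div_eq_mul_inv, ← WithZero.exp_neg, ← WithZero.exp_add, WithZero.exp_le_exp]; omega,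
        by rw [eϖ, ← WithZero.exp_neg, ez, WithZero.exp_le_exp]; omega⟩
    rcases cover_arith (k := 0) hm (Nat.zero_le m) hrr hss hr1 hr2 hs1 hs2 hal hz0' hxx' hoff' hshal' with ⟨h1, h2, h3, h4, h5, h6, h7⟩ | ⟨hk1, -, -, -, -, -⟩
    · -- family X with `c₁`
      obtain ⟨u, huN, hj, ε, hε, h00⟩ := exists_familyX_witness_twoDepth σ hJ hσ hvσ hvϖ r s r' s' Jg hJg hm hnb hrel hx1 hz1
        (by rw [eϖ, eϖ, ex, ← WithZero.exp_add, WithZero.exp_le_exp]; omega)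
        (by rw [eϖ, eϖ, ex, ez, ← WithZero.exp_add, ← WithZero.exp_add, WithZero.exp_le_exp]; omega)
        (by rw [eϖ, ex, ez, hvϖ, ← WithZero.exp_add, ← WithZero.exp_add, ← WithZero.exp_add, WithZero.exp_le_exp]; omega)
        h4 h5 h6 h7 hc₁ ht hvt
      exact ⟨u, huN, hj, ε, hε, h00⟩
    · -- family Z: impossible at `k = 0`
      exact absurd hk1 (by omega)

end Summit.HodgeConjecture.HodgeConjecture.R90.S1.BranchBDepthWitnessKZero

end
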